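import Summits.KontsevichZagierPeriods.KontsevichZagierPeriods.Theorems.RootDecompWalshStrataConicDouble03

/-!
# Root decomposition & Walsh strata — the conic-wall terminal, part 5d: no `R₄` hypothesis for `c < 0` (gen 8, §36.10)

Route `RootDecompWalshStrata`, leaf `QuadricBakerDescent` (stmt-27597), residual R-E2 (NODE.md, decomp-kz-lens-4).
For `c < 0` the resolvent `R₄ = ((kΛ)² − ck²)((kΛ̄)² − ck²)` is POSITIVE wherever the radicand `δ` is
non-negative, so its real zeros sit strictly inside `{δ < 0}`, away from the closure of the domain
(`δ > 0` there).  Splitting the domain at the rational vertex `m = −δf/(2δe)` of `δ` makes `δ` monotone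
on each half; the non-negativity set of a monotone continuous function on a compact rational interval is a
compact interval `[α, β]` on which `R₄ ≠ 0`, and openness of `{R₄ ≠ 0}` gives a rational hull
`[lo′, hi′] ⊋ [α, β]` free of zeros of `R₄` (`exists_rat_hull`).  Result: `InBaker.conic_height_cneg` —
the conic-wall height terminal with NO `R₄` hypothesis: `k ≠ 0`, `a ≠ 0`, `κ₀ > 0 ≤ κ₁`, `c < 0`,
bounded heights, `δ > 0` on the domain, integrand `= pheight`. [KontsevichZagier2001 §1.2; this node]
-/

noncomputable section

open Set MeasureTheory Literature.NumberTheory.Transcendental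
open Literature.ModelTheory.ExponentialFields (IsSemialgebraic isSemialgebraic_univ)

namespace Summit.KontsevichZagierPeriods.RootDecompWalshStrata.ConicDescent

/-! #### 36.10 Removing the `R₄` hypothesis for `c < 0` -/

/-- **RATIONAL HULL LEMMA.**  If `f` is continuous and monotone or antitone on the compact rational
interval `J = [p, q]`, `g` is continuous and non-zero on `{y ∈ J | f y ≥ 0}`, and `D ⊆ J` is a non-empty
set on which `f > 0`, then `D` lies in a compact RATIONAL interval on which `g ≠ 0`. [this node] -/
theorem exists_rat_hull (p q : ℚ) (f g : ℝ → ℝ) (hf : Continuous f) (hg : Continuous g)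
    (hmono : MonotoneOn f (Icc (p : ℝ) q) ∨ AntitoneOn f (Icc (p : ℝ) q))
    (hpos : ∀ y ∈ Icc (p : ℝ) q, 0 ≤ f y → g y ≠ 0) (D : Set ℝ) (hD : D ⊆ Icc (p : ℝ) q)
    (hfD : ∀ y ∈ D, 0 < f y) (hne : D.Nonempty) :
    ∃ lo hi : ℚ, (∀ y ∈ D, (lo : ℝ) ≤ y ∧ y ≤ hi) ∧
      ∀ x : ℝ, (lo : ℝ) ≤ x → x ≤ hi → g x ≠ 0 := by
  set K : Set ℝ := Icc (p : ℝ) q ∩ {y | 0 ≤ f y} with hK_def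
  have hKc : IsCompact K := isCompact_Icc.inter_right (isClosed_le continuous_const hf)
  have hDK : D ⊆ K := fun y hy => ⟨hD hy, (hfD y hy).le⟩
  have hKne : K.Nonempty := hne.mono hDK
  have hαK : sInf K ∈ K := hKc.sInf_mem hKne
  have hβK : sSup K ∈ K := hKc.sSup_mem hKne
  set α := sInf K with hα_def
  set β := sSup K with hβ_def
  -- `[α, β] ⊆ K` by monotonicity
  have hKI : ∀ x, α ≤ x → x ≤ β → x ∈ K := fun x h1 h2 => by
    have hxJ : x ∈ Icc (p : ℝ) q := ⟨hαK.1.1.trans h1, h2.trans hβK.1.2⟩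
    refine ⟨hxJ, ?_⟩
    rcases hmono with hm | hm
    · exact hαK.2.trans (hm hαK.1 hxJ h1)
    · exact hβK.2.trans (hm hxJ hβK.1 h2)
  have hU : IsOpen {x | g x ≠ 0} := isOpen_ne_fun hg continuous_const
  obtain ⟨ε₁, hε₁, hb₁⟩ := Metric.isOpen_iff.1 hU α (hpos α hαK.1 hαK.2)
  obtain ⟨ε₂, hε₂, hb₂⟩ := Metric.isOpen_iff.1 hU β (hpos β hβK.1 hβK.2)
  obtain ⟨lo, hlo₁, hlo₂⟩ := exists_rat_btwn (show α - ε₁ < α by linarith)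
  obtain ⟨hi, hhi₁, hhi₂⟩ := exists_rat_btwn (show β < β + ε₂ by linarith)
  refine ⟨lo, hi, fun y hy => ⟨hlo₂.le.trans (csInf_le hKc.bddBelow (hDK hy)),
    (le_csSup hKc.bddAbove (hDK hy)).trans hhi₁.le⟩, fun x hx1 hx2 => ?_⟩
  rcases lt_or_ge x α with hxa | hxa
  · refine hb₁ ?_
    rw [Metric.mem_ball, Real.dist_eq, abs_lt]
    constructor <;> linarith
  rcases le_or_gt x β with hxb | hxb
  · exact hpos x (hKI x hxa hxb).1 (hKI x hxa hxb).2
  · refine hb₂ ?_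
    rw [Metric.mem_ball, Real.dist_eq, abs_lt]
    constructor <;> linarith

namespace ConicWall

variable (W : ConicWall)

/-- The vertex height `m = −δf/(2δe)` of the radicand (`= 0` when `δe = 0`). -/
def mδ : ℚ := -W.δf / (2 * W.δe)

/-- Auxiliary step `δ_sub`. [bookkeeping] -/
theorem δ_sub (y y' : ℝ) : W.δ y' - W.δ y = (y' - y) * (W.δe * (y' + y) + W.δf) := by
  rw [W.δ_eq_qD, W.δ_eq_qD]
  simp only [qD]
  ring

/-- Auxiliary step `continuous_δ`. [bookkeeping] -/
theorem continuous_δ : Continuous W.δ := by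
  have : W.δ = fun y => qD W.δe W.δf W.δg y := funext W.δ_eq_qD
  rw [this]
  unfold qD
  fun_prop

/-- `δ` is monotone or antitone on `[m, ∞)`. -/
theorem δ_mono_Ici : MonotoneOn W.δ (Ici (W.mδ : ℝ)) ∨ AntitoneOn W.δ (Ici (W.mδ : ℝ)) := by
  rcases eq_or_ne W.δe 0 with he | he
  · rcases le_or_gt 0 W.δf with hf | hf
    · left
      intro y _ y' _ hyy'
      have h := W.δ_sub y y'
      have hf' : (0 : ℝ) ≤ W.δf := by exact_mod_cast hf
      rw [he] at h
      push_cast at h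
      nlinarith
    · right
      intro y _ y' _ hyy'
      have h := W.δ_sub y y'
      have hf' : (W.δf : ℝ) < 0 := by exact_mod_cast hf
      rw [he] at h
      push_cast at h
      nlinarith
  · have hm : 2 * (W.δe : ℝ) * W.mδ = -W.δf := by
      have he' : (W.δe : ℝ) ≠ 0 := by exact_mod_cast he
      simp only [mδ]
      push_cast
      field_simp
    rcases lt_or_gt_of_ne he with hneg | hpos
    · right
      intro y hy y' hy' hyy'
      have h := W.δ_sub y y'
      have he' : (W.δe : ℝ) < 0 := by exact_mod_cast hneg
      have h1 : (W.δe : ℝ) * y ≤ W.δe * W.mδ := mul_le_mul_of_nonpos_left hy he'.le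
      have h2 : (W.δe : ℝ) * y' ≤ W.δe * W.mδ := mul_le_mul_of_nonpos_left hy' he'.le
      nlinarith
    · left
      intro y hy y' hy' hyy'
      have h := W.δ_sub y y'
      have he' : (0 : ℝ) < W.δe := by exact_mod_cast hpos
      have h1 : (W.δe : ℝ) * W.mδ ≤ W.δe * y := mul_le_mul_of_nonneg_left hy he'.le
      have h2 : (W.δe : ℝ) * W.mδ ≤ W.δe * y' := mul_le_mul_of_nonneg_left hy' he'.le
      nlinarith

/-- `δ` is monotone or antitone on `(−∞, m]`. -/
theorem δ_mono_Iic : MonotoneOn W.δ (Iic (W.mδ : ℝ)) ∨ AntitoneOn W.δ (Iic (W.mδ : ℝ)) := by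
  rcases eq_or_ne W.δe 0 with he | he
  · rcases le_or_gt 0 W.δf with hf | hf
    · left
      intro y _ y' _ hyy'
      have h := W.δ_sub y y'
      have hf' : (0 : ℝ) ≤ W.δf := by exact_mod_cast hf
      rw [he] at h
      push_cast at h
      nlinarith
    · right
      intro y _ y' _ hyy'
      have h := W.δ_sub y y'
      have hf' : (W.δf : ℝ) < 0 := by exact_mod_cast hf
      rw [he] at h
      push_cast at h
      nlinarith
  · have hm : 2 * (W.δe : ℝ) * W.mδ = -W.δf := by
      have he' : (W.δe : ℝ) ≠ 0 := by exact_mod_cast he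
      simp only [mδ]
      push_cast
      field_simp
    rcases lt_or_gt_of_ne he with hneg | hpos
    · left
      intro y hy y' hy' hyy'
      have h := W.δ_sub y y'
      have he' : (W.δe : ℝ) < 0 := by exact_mod_cast hneg
      have h1 : (W.δe : ℝ) * W.mδ ≤ W.δe * y := mul_le_mul_of_nonpos_left hy he'.le
      have h2 : (W.δe : ℝ) * W.mδ ≤ W.δe * y' := mul_le_mul_of_nonpos_left hy' he'.le
      nlinarith
    · right
      intro y hy y' hy' hyy'
      have h := W.δ_sub y y'
      have he' : (0 : ℝ) < W.δe := by exact_mod_cast hpos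
      have h1 : (W.δe : ℝ) * y ≤ W.δe * W.mδ := mul_le_mul_of_nonneg_left hy he'.le
      have h2 : (W.δe : ℝ) * y' ≤ W.δe * W.mδ := mul_le_mul_of_nonneg_left hy' he'.le
      nlinarith

/-- For `c < 0` (and `k ≠ 0`) the resolvent `R₄` does not vanish where `δ ≥ 0`. -/
theorem aeval_R4Y_ne_zero_of_c_neg (hk : W.k ≠ 0) (hc : W.c < 0) (y : ℝ) (hδ : 0 ≤ W.δ y) :
    Polynomial.aeval y W.R4Y ≠ 0 := by
  rw [W.aeval_R4Y y hδ]
  have hk' : (W.k : ℝ) ≠ 0 := by exact_mod_cast hk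
  have hc' : (W.c : ℝ) < 0 := by exact_mod_cast hc
  have hck : 0 < -(W.c : ℝ) * W.k ^ 2 := mul_pos (neg_pos.2 hc') (by positivity)
  refine mul_ne_zero (ne_of_gt ?_) (ne_of_gt ?_)
  · nlinarith [sq_nonneg (W.P y + W.l₁ * √(W.δ y))]
  · nlinarith [sq_nonneg (W.P y - W.l₁ * √(W.δ y))]

end ConicWall

/-- One monotone half: the terminal on a domain of heights inside a rational interval on which `δ` is
monotone or antitone (`c < 0`, no `R₄` hypothesis). -/
theorem InBaker.conic_height_cneg_half (W : ConicWall) (γ ε : ℚ) (hε : ε = 1 ∨ ε = -1)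
    (hk : W.k ≠ 0) (ha : W.a ≠ 0) (hκ : 0 < W.κ₀ ∧ 0 ≤ W.κ₁) (hc : W.c < 0) (p q : ℚ)
    (hmono : MonotoneOn W.δ (Icc (p : ℝ) q) ∨ AntitoneOn W.δ (Icc (p : ℝ) q))
    (r : KZ.IntegralRep 1) (hdom : ∀ v ∈ r.domain, (p : ℝ) ≤ v 0 ∧ v 0 ≤ q)
    (hδ : ∀ v ∈ r.domain, 0 < W.δ (v 0))
    (hr : EqOn r.integrand (BallCube.pheight W.κ₀ W.κ₁ γ W.a W.c (W.Xb ε) (W.Xb' ε)) r.domain) :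
    InBaker (KZ.of r) := by
  rcases r.domain.eq_empty_or_nonempty with h0 | ⟨v₀, hv₀⟩
  · exact InBaker.of_domain_eq_empty r h0
  obtain ⟨lo, hi, hD, hR4⟩ := exists_rat_hull p q W.δ (fun x => Polynomial.aeval x W.R4Y)
    W.continuous_δ (Polynomial.continuous_aeval W.R4Y) hmono
    (fun y _ hy => W.aeval_R4Y_ne_zero_of_c_neg hk hc y hy) {y | ∃ v ∈ r.domain, v 0 = y}
    (fun y ⟨v, hv, hvy⟩ => hvy ▸ ⟨(hdom v hv).1, (hdom v hv).2⟩)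
    (fun y ⟨v, hv, hvy⟩ => hvy ▸ hδ v hv) ⟨v₀ 0, v₀, hv₀, rfl⟩
  exact InBaker.conic_height_all' W γ ε hε hk ha hκ hc lo hi hR4 r
    (fun v hv => hD (v 0) ⟨v, hv, rfl⟩) hδ hr

/-- **CONIC-WALL HEIGHT TERMINAL for `c < 0`, no `R₄` hypothesis.**  Every radicand stratum, both
branches; hypotheses: `k ≠ 0`, `a ≠ 0`, `0 < κ₀`, `0 ≤ κ₁`, `c < 0`, heights in a rational interval,
`δ > 0` on the domain, integrand `= pheight`.  [KontsevichZagier2001 §1.2; this node] -/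
theorem InBaker.conic_height_cneg (W : ConicWall) (γ ε : ℚ) (hε : ε = 1 ∨ ε = -1) (hk : W.k ≠ 0)
    (ha : W.a ≠ 0) (hκ : 0 < W.κ₀ ∧ 0 ≤ W.κ₁) (hc : W.c < 0) (lo hi : ℚ)
    (r : KZ.IntegralRep 1) (hdom : ∀ v ∈ r.domain, (lo : ℝ) ≤ v 0 ∧ v 0 ≤ hi)
    (hδ : ∀ v ∈ r.domain, 0 < W.δ (v 0))
    (hr : EqOn r.integrand (BallCube.pheight W.κ₀ W.κ₁ γ W.a W.c (W.Xb ε) (W.Xb' ε)) r.domain) :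
    InBaker (KZ.of r) := by
  refine InBaker.of_split_at W.mδ r (fun r₁ hd₁ hi₁ => ?_) (fun r₁ hd₁ hi₁ => ?_)
  · refine InBaker.conic_height_cneg_half W γ ε hε hk ha hκ hc W.mδ hi
      ((W.δ_mono_Ici).imp (fun h => h.mono fun x hx => hx.1) fun h => h.mono fun x hx => hx.1)
      r₁ (fun v hv => ?_) (fun v hv => ?_) fun v hv => ?_
    · rw [hd₁] at hv
      exact ⟨hv.2.le, (hdom v hv.1).2⟩
    · rw [hd₁] at hv
      exact hδ v hv.1
    · have hv' : v ∈ r.domain := by rw [hd₁] at hv; exact hv.1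
      rw [hi₁]
      exact hr hv'
  · refine InBaker.conic_height_cneg_half W γ ε hε hk ha hκ hc lo W.mδ
      ((W.δ_mono_Iic).imp (fun h => h.mono fun x hx => hx.2) fun h => h.mono fun x hx => hx.2)
      r₁ (fun v hv => ?_) (fun v hv => ?_) fun v hv => ?_
    · rw [hd₁] at hv
      exact ⟨(hdom v hv.1).1, hv.2.le⟩
    · rw [hd₁] at hv
      exact hδ v hv.1
    · have hv' : v ∈ r.domain := by rw [hd₁] at hv; exact hv.1
      rw [hi₁]
      exact hr hv'

end Summit.KontsevichZagierPeriods.RootDecompWalshStrata.ConicDescent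

end
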